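import Summits.ResolutionOfSingularities.ResolutionOfSingularities.Theorems.EquisingularLiftEquisingularLiftNatSpecimenConeNonsingular
import Literature.AlgebraicGeometry.Resolution.RegularLocalRingsJacobian
import Mathlib.RingTheory.Nullstellensatz
import Mathlib.Algebra.MvPolynomial.Funext
import HarnessLib

/-!
# [OURS · L1 W4.5(b)] The hypothesis of the cone theorem IS the Jacobian criterion — and the `A₁` cone
# (crux `Theses.EquisingularLift.EquisingularLiftNat`, stmt-ResolutionOfSingularities-20038)

NOT a statement of any manuscript; OURS kernel theorem (cell `res-hironaka`, chain w45b; seat res-D-pv-013, own initiative, counted 0). AI-written,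
weaker than expert review. No definition, no `sorry`, standard axioms.

`Cone.elNatAt_cone` (p524856) asks that the three affine charts `K[T₀,T₁,T₂]/(G|_{Tᵢ := 1})` of the plane form `G` be regular rings;
`…SpecimenConeNonsingular` (p526332) derived this from the projective Jacobian criterion `IsNonsingularForm K G`. Here the CONVERSE, over an
algebraically closed field and in any number `n + 2` of variables:

* `pderiv_self_aeval_update_one` — `∂ᵢ (G|_{Tᵢ := 1}) = 0`;
* `aeval_update_one_ne_zero_of_isHomogeneous` — `G|_{Tᵢ := 1} ≠ 0` for a non-zero form `G` (infinite `K`);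
* **`isNonsingularForm_of_isRegularRing_charts`** — if every chart `K[T]/(G|_{Tᵢ := 1})` is a regular ring then `IsNonsingularForm K G`
  (`K` algebraically closed, `G ≠ 0` homogeneous): a prime `𝔭 ∋ G, ∂G` missing `Tᵢ` has a zero `a` with `aᵢ ≠ 0` (Nullstellensatz, Mathlib
  `MvPolynomial.IsPrime.vanishingIdeal_zeroLocus`); rescaled to `aᵢ = 1` it is a point of the chart at which `G|_{Tᵢ:=1}` and its gradient vanish,
  so the chart is not regular there (tree `Resolution.not_isRegularLocalRing_localization_of_pderiv_eval_eq_zero`, Hartshorne I 5.1 / Matsumura 14.2);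
* **`isNonsingularForm_iff_isRegularRing_charts`** — the equivalence: the hypothesis `hreg` of `Cone.elNatAt_cone` is EXACTLY smoothness of the
  base curve `V₊(G) ⊂ ℙ²` in the tree's Jacobian spelling;
* **`elNatAt_quadricCone`** — instance: EL♮ at the ordinary double point `A₁`, the vertex of the cone `V₊(x₁x₃ − x₂²) ⊂ ℙ³_K` over the smooth
  conic `T₀T₂ − T₁²`, in EVERY characteristic `p` (including `p = 2`: `isNonsingularForm_quadric` by hand).

References: Hartshorne 1977 I Thm. 5.1, I Ex. 5.8; Matsumura 1986 Thm. 14.2; Mathlib's Nullstellensatz.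
-/

set_option linter.dupNamespace false -- mandated namespace `Summit.<Summit>.<Problem>` of this single-conjunct summit

noncomputable section

open MvPolynomial
open Literature.AlgebraicGeometry.Resolution
open Literature.AlgebraicGeometry.Motives Literature.AlgebraicGeometry.Motives.SmoothHypersurface
open Summit.ResolutionOfSingularities.ResolutionOfSingularities.Theorems.EquisingularLift.SpecimenQuartic

namespace Summit.ResolutionOfSingularities.ResolutionOfSingularities.Cruxes.EquisingularLiftNat.Sections

namespace Cone

variable (K : Type) [Field K]

/-! ## Two more dehomogenisation lemmas -/

/-- **`∂ᵢ` kills the chart `Tᵢ := 1`**: `∂ᵢ (G|_{Tᵢ := 1}) = 0`. [folklore] -/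
theorem pderiv_self_aeval_update_one {σ : Type*} [DecidableEq σ] (G : MvPolynomial σ K) (i : σ) :
    pderiv i (aeval (Function.update (X : σ → MvPolynomial σ K) i 1) G) = 0 := by
  induction G using MvPolynomial.induction_on with
  | C a => simp
  | add p q hp hq => rw [map_add, map_add, hp, hq, add_zero]
  | mul_X p m hp =>
    rw [map_mul, aeval_X, Derivation.leibniz, hp, smul_zero, add_zero]
    by_cases hm : m = i
    · subst hm
      rw [Function.update_self, Derivation.map_one_eq_zero, smul_zero]
    · rw [Function.update_of_ne hm, pderiv_X_of_ne hm, smul_zero]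

/-- Evaluating the chart equation: `(G|_{Tᵢ := 1})(b) = G(b)` whenever `bᵢ = 1`. [folklore] -/
theorem aeval_aeval_update_one {σ : Type*} [DecidableEq σ] (G : MvPolynomial σ K) (i : σ) (b : σ → K) (hbi : b i = 1) :
    aeval b (aeval (Function.update (X : σ → MvPolynomial σ K) i 1) G) = aeval b G := by
  rw [← AlgHom.comp_apply, comp_aeval]
  have hfun : (fun m => aeval b (Function.update (X : σ → MvPolynomial σ K) i 1 m)) = b := by
    funext m
    by_cases hm : m = i
    · subst hm
      rw [Function.update_self, map_one, hbi]
    · rw [Function.update_of_ne hm, aeval_X]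
  rw [hfun]

/-- **A non-zero FORM has non-zero affine charts**: `G|_{Tᵢ := 1} ≠ 0` for `G ≠ 0` homogeneous (over an infinite field: pick `a` with
`G(a)·aᵢ ≠ 0` and rescale to `aᵢ = 1`). [folklore] -/
theorem aeval_update_one_ne_zero_of_isHomogeneous {σ : Type*} [Fintype σ] [DecidableEq σ] [Infinite K] {G : MvPolynomial σ K} {d : ℕ}
    (hG : G.IsHomogeneous d) (hG0 : G ≠ 0) (i : σ) :
    aeval (Function.update (X : σ → MvPolynomial σ K) i 1) G ≠ 0 := by
  obtain ⟨a, ha⟩ : ∃ a : σ → K, eval a (G * X i) ≠ 0 := by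
    by_contra h
    push Not at h
    exact (mul_ne_zero hG0 (X_ne_zero i)) (MvPolynomial.funext fun a => by rw [h a, map_zero])
  rw [map_mul, eval_X] at ha
  have hGa : aeval a G ≠ 0 := by rw [aeval_eq_eval]; exact left_ne_zero_of_mul ha
  have hai : a i ≠ 0 := right_ne_zero_of_mul ha
  intro h0
  set b : σ → K := fun m => (a i)⁻¹ * a m with hb
  have hbi : b i = 1 := inv_mul_cancel₀ hai
  have h1 : aeval b (aeval (Function.update (X : σ → MvPolynomial σ K) i 1) G) = 0 := by rw [h0, map_zero]
  rw [aeval_aeval_update_one K G i b hbi, hb, aeval_smul_eq_pow_mul_aeval hG] at h1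
  exact (mul_ne_zero (pow_ne_zero _ (inv_ne_zero hai)) hGa) h1

/-! ## Regular charts ⇒ nonsingular form (Nullstellensatz + Jacobian criterion) -/

/-- **Regular affine charts force the projective Jacobian criterion.** Over an algebraically closed field `K`, a non-zero form
`G ∈ K[T₀,…,T_{n+1}]` all of whose charts `K[T]/(G|_{Tᵢ := 1})` are regular rings satisfies `IsNonsingularForm K G`.
[cite: Hartshorne1977, I Thm. 5.1, I Ex. 5.8] -/
theorem isNonsingularForm_of_isRegularRing_charts [IsAlgClosed K] {n : ℕ} (G : MvPolynomial (Fin (n + 2)) K) {d : ℕ}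
    (hG : G.IsHomogeneous d) (hG0 : G ≠ 0)
    (hreg : ∀ i : Fin (n + 2), IsRegularRing (MvPolynomial (Fin (n + 2)) K ⧸
      Ideal.span {aeval (Function.update (X : Fin (n + 2) → MvPolynomial (Fin (n + 2)) K) i 1) G})) :
    IsNonsingularForm K G := by
  intro 𝔭 h𝔭 hGp hdp i
  by_contra hXi
  haveI := h𝔭
  -- Nullstellensatz: a zero `a` of `𝔭` with `aᵢ ≠ 0`
  have hrad : (X i : MvPolynomial (Fin (n + 2)) K) ∉ vanishingIdeal K (zeroLocus K 𝔭) := by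
    rwa [MvPolynomial.IsPrime.vanishingIdeal_zeroLocus 𝔭]
  simp only [mem_vanishingIdeal_iff, not_forall] at hrad
  obtain ⟨a, ha, hai⟩ := hrad
  rw [aeval_X] at hai
  rw [mem_zeroLocus_iff] at ha
  have hGa : aeval a G = 0 := ha G hGp
  have hda : ∀ j, aeval a (pderiv j G) = 0 := fun j => ha _ (hdp j)
  -- rescale into the chart `Tᵢ = 1`
  set b : Fin (n + 2) → K := fun m => (a i)⁻¹ * a m with hb
  have hbi : b i = 1 := inv_mul_cancel₀ hai
  have hGb : aeval b G = 0 := by rw [hb, aeval_smul_eq_pow_mul_aeval hG, hGa, mul_zero]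
  have hdb : ∀ j, aeval b (pderiv j G) = 0 := fun j => by
    rw [hb, aeval_smul_eq_pow_mul_aeval hG.pderiv, hda j, mul_zero]
  -- the chart equation and its gradient vanish at `b`
  set g := aeval (Function.update (X : Fin (n + 2) → MvPolynomial (Fin (n + 2)) K) i 1) G with hg
  have hgb : eval b g = 0 := by rw [← aeval_eq_eval, hg, aeval_aeval_update_one K G i b hbi, hGb]
  have hdgb : ∀ j, eval b (pderiv j g) = 0 := by
    intro j
    by_cases hj : j = i
    · subst hj
      rw [hg, pderiv_self_aeval_update_one, map_zero]
    · rw [← aeval_eq_eval, hg, pderiv_aeval_update_one K G i j hj, aeval_aeval_update_one K _ i b hbi, hdb]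
  have hg0 : g ≠ 0 := aeval_update_one_ne_zero_of_isHomogeneous K hG hG0 i
  -- the point `𝔫 = ker (eval b) ⊇ (g)` of the chart, read in `K[T]/(g)`
  have hle : Ideal.span {g} ≤ RingHom.ker (eval b) :=
    (Ideal.span_singleton_le_iff_mem _).mpr ((RingHom.mem_ker).mpr hgb)
  haveI h𝔫 : (RingHom.ker (eval b) : Ideal (MvPolynomial (Fin (n + 2)) K)).IsMaximal :=
    RingHom.ker_isMaximal_of_surjective (eval b) fun x => ⟨C x, eval_C x⟩
  set P : Ideal (MvPolynomial (Fin (n + 2)) K ⧸ Ideal.span {g}) :=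
    (RingHom.ker (eval b)).map (Ideal.Quotient.mk (Ideal.span {g})) with hP
  have hPcomap : P.comap (Ideal.Quotient.mk (Ideal.span {g})) = RingHom.ker (eval b) := by
    rw [hP, Ideal.comap_map_of_surjective _ Ideal.Quotient.mk_surjective, ← RingHom.ker_eq_comap_bot, Ideal.mk_ker,
      sup_eq_left.mpr hle]
  haveI hPmax : P.IsMaximal := by
    refine (Ideal.map_eq_top_or_isMaximal_of_surjective _ Ideal.Quotient.mk_surjective h𝔫).resolve_left fun htop => ?_
    have h := hPcomap
    rw [hP, htop, Ideal.comap_top] at h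
    exact h𝔫.ne_top h.symm
  haveI := hreg i
  exact not_isRegularLocalRing_localization_of_pderiv_eval_eq_zero b hg0 hgb hdgb P hPcomap
    (IsRegularRing.isRegularLocalRing_localization P)

/-- **THE HYPOTHESIS OF THE CONE THEOREM IS THE JACOBIAN CRITERION.** For a non-zero form `G ∈ K[T₀,…,T_{n+1}]` over an algebraically
closed field: `IsNonsingularForm K G` **iff** every affine chart `K[T]/(G|_{Tᵢ := 1})` is a regular ring (⇒ p526332, ⇐ above). At `n = 1`
the right-hand side is literally the hypothesis `hreg` of `Cone.elNatAt_cone` (p524856). [cite: Hartshorne1977, I Thm. 5.1, I Ex. 5.8] -/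
theorem isNonsingularForm_iff_isRegularRing_charts [IsAlgClosed K] {n : ℕ} (G : MvPolynomial (Fin (n + 2)) K) {d : ℕ}
    (hG : G.IsHomogeneous d) (hG0 : G ≠ 0) :
    IsNonsingularForm K G ↔ ∀ i : Fin (n + 2), IsRegularRing (MvPolynomial (Fin (n + 2)) K ⧸
      Ideal.span {aeval (Function.update (X : Fin (n + 2) → MvPolynomial (Fin (n + 2)) K) i 1) G}) :=
  ⟨fun h i => isRegularRing_quotient_aeval_update_one_of_isNonsingularForm K G hG h i,
    isNonsingularForm_of_isRegularRing_charts K G hG hG0⟩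

/-! ## The `A₁` cone: EL♮ at an ordinary double point, every characteristic -/

/-- The conic `T₀T₂ − T₁²` is a form of degree `2`. [folklore] -/
theorem isHomogeneous_quadric : (X 0 * X 2 - X 1 ^ 2 : MvPolynomial (Fin 3) K).IsHomogeneous 2 :=
  ((isHomogeneous_X K 0).mul (isHomogeneous_X K 2)).sub ((isHomogeneous_X K 1).pow 2)

/-- **The conic `T₀T₂ − T₁²` is a nonsingular form over EVERY field** (also in characteristic `2`): a prime containing it and its partials
`T₂, −2T₁, T₀` contains `T₀, T₂`, hence `T₁² = T₀T₂ − (T₀T₂ − T₁²)`, hence `T₁`. [folklore] -/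
theorem isNonsingularForm_quadric : IsNonsingularForm K (X 0 * X 2 - X 1 ^ 2 : MvPolynomial (Fin 3) K) := by
  intro 𝔭 h𝔭 hF hd i
  have h2 : (X 2 : MvPolynomial (Fin 3) K) ∈ 𝔭 := by
    have h := hd 0
    simp only [map_sub, Derivation.leibniz, Derivation.leibniz_pow, pderiv_X_self, smul_eq_mul, mul_one,
      pderiv_X_of_ne (show (2 : Fin 3) ≠ 0 by decide), pderiv_X_of_ne (show (1 : Fin 3) ≠ 0 by decide),
      mul_zero, smul_zero, zero_add, sub_zero] at h
    exact h
  have h0 : (X 0 : MvPolynomial (Fin 3) K) ∈ 𝔭 := by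
    have h := hd 2
    simp only [map_sub, Derivation.leibniz, Derivation.leibniz_pow, pderiv_X_self, smul_eq_mul, mul_one,
      pderiv_X_of_ne (show (0 : Fin 3) ≠ 2 by decide), pderiv_X_of_ne (show (1 : Fin 3) ≠ 2 by decide),
      mul_zero, smul_zero, add_zero, sub_zero] at h
    exact h
  have h1 : (X 1 : MvPolynomial (Fin 3) K) ∈ 𝔭 := by
    refine h𝔭.mem_of_pow_mem 2 ?_
    have h : (X 1 : MvPolynomial (Fin 3) K) ^ 2 = X 0 * X 2 - (X 0 * X 2 - X 1 ^ 2) := by ring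
    rw [h]
    exact 𝔭.sub_mem (𝔭.mul_mem_left _ h2) hF
  fin_cases i
  · exact h0
  · exact h1
  · exact h2

/-- In `ℙ³` the cone over the conic reads `x₁x₃ − x₂²`. [folklore] -/
theorem rename_succ_quadric :
    (rename Fin.succ (X 0 * X 2 - X 1 ^ 2 : MvPolynomial (Fin 3) K) : MvPolynomial (Fin 4) K) = X 1 * X 3 - X 2 ^ 2 := by
  simp [map_sub, map_mul, map_pow, rename_X]

attribute [local instance] MvPolynomial.gradedAlgebra Literature.AlgebraicGeometry.Motives.ProjBaseChange.algebraBase in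
/-- **EL♮ AT THE ORDINARY DOUBLE POINT `A₁`, EVERY CHARACTERISTIC.** The quadric cone `H = V₊(x₁x₃ − x₂²) ⊂ ℙ³_K` (`K` algebraically
closed of characteristic `p`, ANY prime `p`, also `2`) — the cone over the smooth conic, vertex `[1:0:0:0]` an `A₁` surface singularity —
satisfies `Theorems.EquisingularLift.ELNatAt p K 3 H ι`: `elNatAt_cone_of_isNonsingularForm` (p526332) with `isNonsingularForm_quadric`.
[OURS · L1 W4.5b] [folklore] -/
theorem elNatAt_quadricCone (p : ℕ) (hp : p.Prime) (K : Type) [Field K] [CharP K p] [IsAlgClosed K] :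
    Theorems.EquisingularLift.ELNatAt p K 3
      (hypersurface (rename Fin.succ (X 0 * X 2 - X 1 ^ 2 : MvPolynomial (Fin 3) K) : MvPolynomial (Fin 4) K)).left
      (hypersurfaceι (rename Fin.succ (X 0 * X 2 - X 1 ^ 2 : MvPolynomial (Fin 3) K) : MvPolynomial (Fin 4) K)).left :=
  elNatAt_cone_of_isNonsingularForm p hp K _ (isHomogeneous_quadric K) (by norm_num) (isNonsingularForm_quadric K)

attribute [local instance] MvPolynomial.gradedAlgebra Literature.AlgebraicGeometry.Motives.ProjBaseChange.algebraBase in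
/-- The same statement with the equation spelled `x₁x₃ − x₂²` in `K[x₀,…,x₃]`. [folklore] -/
theorem elNatAt_quadricCone' (p : ℕ) (hp : p.Prime) (K : Type) [Field K] [CharP K p] [IsAlgClosed K] :
    Theorems.EquisingularLift.ELNatAt p K 3
      (hypersurface (X 1 * X 3 - X 2 ^ 2 : MvPolynomial (Fin 4) K)).left
      (hypersurfaceι (X 1 * X 3 - X 2 ^ 2 : MvPolynomial (Fin 4) K)).left := by
  have h := elNatAt_quadricCone p hp K
  rw [rename_succ_quadric] at h
  exact h

end Cone

end Summit.ResolutionOfSingularities.ResolutionOfSingularities.Cruxes.EquisingularLiftNat.Sections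

end
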